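/-
Copyright (c) 2026 the pub-hodgecm-mathlib formalisation cell (harness21).  Prover seat hodgecm-mathlib-K2Liu-p02 (g4), Track B «K2-LIT» ∕
hLiu418 #184♮, socket #42N «MODEL IDENTIFICATION» of the #42R road, FILE (P3) of road (N″) «by the see-saw permutation» — THE ASSEMBLY
(LEAD F0P6-plan (g11) rulings «M-155k» (9), «M-155m» (2)), 2026-09-04.
-/
import Summits.HodgeConjecture.HodgeConjecture.Theorems.K2LiuUndoublingSeesawPermutationSymplectic

/-!
# Crux `HLiu418`, road `K2_Liu`, socket #42N — FILE (P3): the χ-attached PAIR splitting of `(V₁ ⊕ (−V₁), W)` on `U(V)(𝔸) = H(V₁)(𝔸)`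
# IS the doubled Weil representation of the datum `(V₁, W)` — «model (ii) ∘ inl = model (i)», on the nose

Cell `hodgecm-mathlib`, crux item hLiu418 = `stmt-HodgeConjecture-24832`; squad K2 ∕ K2Liu, prover K2Liu-p02 (g4), steward lineage of socket #42R.
THEOREMS ONLY (no `def` ∕ instance ∕ notation ∕ named-fact hypothesis ∕ `sorry`); lane `--supports stmt-HodgeConjecture-24832 --as helper`
(count-neutral).  Assembly of ★ (P1) `K2LiuUndoublingSeesawPermutation`, ★ (P2) `…Mem`, ★ (P2b) `…Symplectic`, the Weil side ★
`Weil1964.AdelicMetaplecticLeviPermutation` (K2E2-p12 (g3)), over the template ★ `DoubledSeesawUndoubling.omega_chiSplitting_sumTensor_idxSplit`.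

SETTING.  `V = V₁ ⊕ V₂` hermitian of rank `N + N` over the CM field `L`, diagonalised by `dV = (dA ‖ dB)` with **`V₂ = −V₁`** (`dB = −dA`);
`W = ⟨dW 0⟩` a line; enumerations `e₁ : Fin (N+N) × Fin 1 ≃ Fin n_V` (pair datum `(V, W)`) and `e₀ : Fin N × Fin 1 ≃ Fin N`, `e₀⁻¹ m = (m, 0)`
(the datum `(V₁, W)`, whose DOUBLED group `H(V₁)(𝔸) = U(V₁ ⊕ V₁⁻)(𝔸)` IS `U(V)(𝔸)` — ★ `HA_e₀_eq_adelic`).  Model (ii) := the χ-attached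
compatible pair splitting ★ `chiSplitting χ = undoubleHom (doubledWeilRep χ)` of `(V, W)` («`ι̃_{V,χ}` determined by doubling»), read on
`U(V)(𝔸)` through `a(x) = x ⊗ 1` (★ `adelicInl`); model (i) := ★ `doubledWeilRep χ` of `(V₁, W)`.

* §1 the conjugation identity in `Mp(𝕎^𝔻_V)` read on the τ-pure tensors `Ψ ⊠_{ρ ≫ σ} Ψ₂` (`σ = idxSplitD e₁ e₀ e₀`, `ρ` the see-saw permutation):
  **`ω(s^𝔻_V(ι(x ⊗ 1))) (Ψ ⊠_{ρ ≫ σ} Ψ₂) = (ω(s^𝔻_{V₁} h₁) Ψ) ⊠_{ρ ≫ σ} Ψ₂`** (`omegaD_inlG_adelicInl_sumTensor`) — from ★ `inlG (x ⊗ 1) = δ′⁻¹ · blkD(h₁,1) · δ′`,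
  ★ `omega_blkD_inl_sumTensor` on `σ`-tensors, ★ «`ω(s^𝔻_V δ′) = c • R_ρ`» (the scalar `c` CANCELS) and ★ `R_ρ (Ψ ⊠_{ρ ≫ σ} Ψ₂) = Ψ ⊠_σ Ψ₂`;
* §2 **THE MODEL IDENTIFICATION** (`omega_chiSplitting_adelicInl`): for `x ∈ U(V)(𝔸)` and `h₁ ∈ H(V₁)(𝔸)` with the same matrix,
  **`ω(s_χ^{(V,W)}(x ⊗ 1)) (R_r Ψ) = R_r (ω(s^𝔻_{χ,(V₁,W)}(h₁)) Ψ)`** for ALL `Ψ ∈ 𝒮(𝔸^{N+N})`, `R_r` the row relabelling `𝒮(𝔸^{N+N}) ≃ 𝒮(𝔸^{n_V})`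
  along `r = rowEquiv e₁` — by the shuffle ★ `Ψ ⊠_{ρ ≫ σ} Ψ₂ = R_{e₂}(R_r Ψ ⊠ R_r Ψ₂)`, the undoubling product formula ★
  `omegaD_inlG_piSBReindex_symm_tensorToSum` and `⊠`-cancellation ★ `tensorToSum_left_cancel`.  No twist `η`, no (α3) `SiegelDetectsCharacters`:
  the identification is EXACT, because ★ `omega_blkD_inl_sumTensor` already pins the see-saw character to `1`.
* §3 the same with `h₁ := x` read in `H(V₁)(𝔸)` along ★ `HA_e₀_eq_adelic` (`omega_chiSplitting_adelicInl'`).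

HONEST LABEL.  Count-neutral helper; it pays nothing by itself: `HC_CM` is proved only modulo the 7 printed citations (2 remaining named inputs:
hLiu418 = `stmt-HodgeConjecture-24832`, h413 = `stmt-HodgeConjecture-24833`) until rung 0 closes.  What it gives socket #42N: the Weil representation
through which D8's ★ `doubledLineThetaLift` reads `U(𝔻)` (model (ii), `V := (𝔻, dD)`, `W := ⟨a′⟩`) is, on the nose and for every test function, the
doubled Weil representation ★ `doubledWeilRep χ` of the datum `(e₀, t₀ = dD ∘ castAdd, ⟨a′⟩)` whose adelic group is `U(𝔻)(𝔸)` itself.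
References: [HarrisKudlaSweet1996] §1 (1.14)–(1.15), App. A Lem. A.2–Cor. A.3; [Kudla1994] §2, Thm. 3.1; [Kudla1984] §1; [Liu2021] Thm. 4.15 proof,
App. B p. 104, App. D Step 2; [GelbartRogawski1991] §3.1 Prop. 3.1.1; [Weil1964] Chap. III n° 37–41.
-/

set_option autoImplicit false
-- the mandated namespace repeats the single-problem summit's segment (`HodgeConjecture.HodgeConjecture`)
set_option linter.dupNamespace false

noncomputable section

open scoped Classical Matrix Kronecker
open NumberField IsDedekindDomain
open Literature.RepresentationTheory.HeisenbergGroup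
open Literature.NumberTheory.Automorphic hiding permGL coe_permGL
open Literature.NumberTheory.Weil1964 Literature.RepresentationTheory.HarrisKudlaSweet1996 Literature.NumberTheory.GaloisRepresentations
open Literature.NumberTheory.GelbartRogawski1991 Literature.NumberTheory.GelbartRogawski1991.UnitaryDualPair
open Literature.NumberTheory.GelbartRogawski1991.GRConstruction
open Literature.NumberTheory.Automorphic.Liu2021.Def411WeilCarriersDoubling
open Summit.HodgeConjecture.HodgeConjecture.Cruxes.HLiu418.K2LiuUndoublingSeesawPermutation
open Summit.HodgeConjecture.HodgeConjecture.Cruxes.HLiu418.K2LiuUndoublingSeesawPermutationMem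
open Summit.HodgeConjecture.HodgeConjecture.Cruxes.HLiu418.K2LiuUndoublingSeesawPermutationSymplectic

namespace Summit.HodgeConjecture.HodgeConjecture.Cruxes.HLiu418.K2LiuUndoublingSeesawAssembly

variable (L : Type) [Field L] [NumberField L] [IsCMField L]
variable {N nV : ℕ} (e₁ : Fin (N + N) × Fin 1 ≃ Fin nV) (e₀ : Fin N × Fin 1 ≃ Fin N) (he₀ : ∀ m, (e₀.symm m).1 = m)
  (dA : Fin N → L) (hdA : ∀ i, IsCMField.complexConj L (dA i) = dA i) (hdA0 : ∀ i, dA i ≠ 0)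
  (dB : Fin N → L) (hdB : ∀ i, IsCMField.complexConj L (dB i) = dB i)
  (dV : Fin (N + N) → L) (hdV : ∀ i, IsCMField.complexConj L (dV i) = dV i) (hdV0 : ∀ i, dV i ≠ 0)
  (hVA : ∀ i, dV (Fin.castAdd N i) = dA i) (hVB : ∀ j, dV (Fin.natAdd N j) = dB j) (hBA : ∀ i, dB i = -dA i)
  (dW : Fin 1 → L) (hdW : ∀ i, IsCMField.complexConj L (dW i) = dW i) (hdW0 : ∀ i, dW i ≠ 0)
  (χ : HeckeCharacter L) (hχu : χ.IsUnitary) (hχs : IsSplittingChar L 1 χ)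

omit [NumberField L] [IsCMField L] in
include hVA hVB hBA in
/-- `V₂ = −V₁` read on `dV`: `dV (natAdd i) = −dV (castAdd i)`. [cite: Kudla1984, §1] -/
theorem dV_natAdd_eq_neg (i : Fin N) : dV (Fin.natAdd N i) = -dV (Fin.castAdd N i) := by
  rw [hVB, hVA, hBA]

omit [NumberField L] [IsCMField L] in
include hBA hdA0 in
/-- `dB = −dA` has no zero entry. [cite: Kudla1984, §1] -/
theorem dB_ne_zero (i : Fin N) : dB i ≠ 0 := by
  rw [hBA]
  exact neg_ne_zero.mpr (hdA0 i)

/-- `ω(s(a·b)) Φ = ω(s a) (ω(s b) Φ)` — multiplicativity of a section read on vectors (stated abstractly: instantiating it, rather than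
rewriting `map_mul` under `ω` over the doubled telescopes, keeps the assembly below inside the default heartbeat budget).
[cite: Weil1964, Chap. III n° 37 p. 188] -/
theorem omega_apply_map_mul {n : ℕ} (e : Fin (N + N) × Fin 1 ≃ Fin n) (sD : HA L e dV hdV dW hdW →* MpD L e dV hdV dW hdW)
    (a b : HA L e dV hdV dW hdW) (Φ : piSchwartzBruhat (Fp L) (Fin (n + n))) :
    adelicMpCont.omega (Fp L) (Fin (n + n)) (gramDA L e dV hdV dW hdW) (sD (a * b)) Φ =
      adelicMpCont.omega (Fp L) (Fin (n + n)) (gramDA L e dV hdV dW hdW) (sD a)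
        (adelicMpCont.omega (Fp L) (Fin (n + n)) (gramDA L e dV hdV dW hdW) (sD b) Φ) := by
  -- (term mode: `rw [map_mul]` under `ω` over these carriers is the isDefEq cliff; `(f * g) Φ = f (g Φ)` is `rfl`)
  exact (congrArg (fun m => adelicMpCont.omega (Fp L) (Fin (n + n)) (gramDA L e dV hdV dW hdW) m Φ) (map_mul sD a b)).trans
    (LinearMap.congr_fun (map_mul (adelicMpCont.omega (Fp L) (Fin (n + n)) (gramDA L e dV hdV dW hdW)) (sD a) (sD b)) Φ)

/-! ## §1 The conjugation identity read on `τ`-pure tensors -/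

include he₀ hVA hVB hBA hdB in
/-- **`ω(s^𝔻_V(ι(x ⊗ 1))) (Ψ ⊠_{ρ ≫ σ} Ψ₂) = (ω(s^𝔻_{V₁} h₁) Ψ) ⊠_{ρ ≫ σ} Ψ₂`**: the doubled Weil representation of `(V, W)` at `ι_V(x ⊗ 1)`,
`x ∈ U(V)(𝔸)`, acts on pure tensors along `ρ ≫ σ` through the doubled Weil representation of `(V₁, W)` at the element `h₁ ∈ H(V₁)(𝔸)` with the
same matrix — ★ `inlG (x ⊗ 1) = δ′⁻¹ · blkD (h₁, 1) · δ′`, ★ `omega_blkD_inl_sumTensor`, ★ `ω(s^𝔻_V δ′) = c • R_ρ` (the scalar cancels) and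
★ `R_ρ (Ψ ⊠_{ρ ≫ σ} Ψ₂) = Ψ ⊠_σ Ψ₂`. [cite: Liu2021, Thm. 4.15 proof l. 2199–2210] [cite: Kudla1994, §2 (doubled space, Siegel parabolic)] [cite: Kudla1984, §1] -/
theorem omegaD_inlG_adelicInl_sumTensor
    (x : UnitaryGroup.adelic (Fp L) L (IsCMField.complexConj L) (N + N) (Matrix.diagonal dV)) (h₁ : HA L e₀ dA hdA dW hdW)
    (hh₁ : (h₁ : GL (Fin (N + N)) (AdeleRing (𝓞 L) L)) = (x : GL (Fin (N + N)) (AdeleRing (𝓞 L) L)))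
    (Ψ Ψ₂ : piSchwartzBruhat (Fp L) (Fin (N + N))) :
    adelicMpCont.omega (Fp L) (Fin (nV + nV)) (gramDA L e₁ dV hdV dW hdW)
        (doubledWeilRep L e₁ dV hdV hdV0 dW hdW hdW0 χ hχu hχs
          (inlG L e₁ dV hdV dW hdW
            (UnitaryGroup.adelicInl (Fp L) L (IsCMField.complexConj L) (N + N) 1 (Matrix.diagonal dV) (Matrix.diagonal dW) x)))
        (sumTensor (Fp L) ((seesawPerm e₁ e₀).trans (idxSplitD e₁ e₀ e₀)) Ψ Ψ₂) =
      sumTensor (Fp L) ((seesawPerm e₁ e₀).trans (idxSplitD e₁ e₀ e₀))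
        (adelicMpCont.omega (Fp L) (Fin (N + N)) (gramDA L e₀ dA hdA dW hdW)
          (doubledWeilRep L e₀ dA hdA hdA0 dW hdW hdW0 χ hχu hχs h₁) Ψ) Ψ₂ := by
  have hV : ∀ i, dV (Fin.natAdd N i) = -dV (Fin.castAdd N i) := dV_natAdd_eq_neg L dA dB dV hVA hVB hBA
  have hdB0 : ∀ i, dB i ≠ 0 := dB_ne_zero L dA hdA0 dB hBA
  have hDV := isDoubledWeilRep_doubledWeilRep L e₁ dV hdV hdV0 dW hdW hdW0 χ hχu hχs
  have hDA := isDoubledWeilRep_doubledWeilRep L e₀ dA hdA hdA0 dW hdW hdW0 χ hχu hχs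
  have hDB := isDoubledWeilRep_doubledWeilRep L e₀ dB hdB hdB0 dW hdW hdW0 χ hχu hχs
  -- (K) the group identity `ι(x ⊗ 1) = δ′⁻¹ · blkD (h₁, 1) · δ′`, read as `δ′ · ι(x ⊗ 1) = blkD (h₁, 1) · δ′`
  have hY : ∀ k k' : Fin (N + N),
      (((UnitaryGroup.adelicInl (Fp L) L (IsCMField.complexConj L) (N + N) 1 (Matrix.diagonal dV) (Matrix.diagonal dW) x :
          UnitaryGroup.adelicPair (Fp L) L (IsCMField.complexConj L) (N + N) 1 (Matrix.diagonal dV) (Matrix.diagonal dW)) :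
          GL (Fin (N + N) × Fin 1) (AdeleRing (𝓞 L) L)) : Matrix (Fin (N + N) × Fin 1) (Fin (N + N) × Fin 1) (AdeleRing (𝓞 L) L))
          (k, (0 : Fin 1)) (k', (0 : Fin 1)) =
        ((h₁ : GL (Fin (N + N)) (AdeleRing (𝓞 L) L)) : Matrix (Fin (N + N)) (Fin (N + N)) (AdeleRing (𝓞 L) L)) k k' := fun k k' => by
    rw [coe_adelicInl_apply_zero, hh₁]
  have hK : inlG L e₁ dV hdV dW hdW
      (UnitaryGroup.adelicInl (Fp L) L (IsCMField.complexConj L) (N + N) 1 (Matrix.diagonal dV) (Matrix.diagonal dW) x) =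
      (⟨K2LiuUndoublingSeesawPermutation.permGL (seesawPerm e₁ e₀), permGL_seesawPerm_mem_HA L e₁ e₀ he₀ dV hdV hV dW hdW⟩ :
          ↥(HA L e₁ dV hdV dW hdW))⁻¹ *
        blkD L e₁ e₀ e₀ dA hdA dB hdB dV hdV hVA hVB dW hdW (h₁, 1) *
        ⟨K2LiuUndoublingSeesawPermutation.permGL (seesawPerm e₁ e₀), permGL_seesawPerm_mem_HA L e₁ e₀ he₀ dV hdV hV dW hdW⟩ := by
    apply Subtype.ext
    apply Units.ext
    rw [Subgroup.coe_mul, Subgroup.coe_mul, Subgroup.coe_inv, Units.val_mul, Units.val_mul]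
    exact coe_inlG_eq_conj_blkD L e₁ e₀ dA hdA dB hdB dV hdV hVA hVB dW hdW _ h₁ hY
  have hK2 : (⟨K2LiuUndoublingSeesawPermutation.permGL (seesawPerm e₁ e₀), permGL_seesawPerm_mem_HA L e₁ e₀ he₀ dV hdV hV dW hdW⟩ :
        ↥(HA L e₁ dV hdV dW hdW)) *
      inlG L e₁ dV hdV dW hdW
        (UnitaryGroup.adelicInl (Fp L) L (IsCMField.complexConj L) (N + N) 1 (Matrix.diagonal dV) (Matrix.diagonal dW) x) =
      blkD L e₁ e₀ e₀ dA hdA dB hdB dV hdV hVA hVB dW hdW (h₁, 1) *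
        ⟨K2LiuUndoublingSeesawPermutation.permGL (seesawPerm e₁ e₀), permGL_seesawPerm_mem_HA L e₁ e₀ he₀ dV hdV hV dW hdW⟩ := by
    rw [hK, mul_assoc, mul_inv_cancel_left]
  -- pushed through `s^𝔻_V` and `ω` (one element at a time: `omega_apply_map_mul`)
  have hΩ := (omega_apply_map_mul L dV hdV dW hdW e₁ (doubledWeilRep L e₁ dV hdV hdV0 dW hdW hdW0 χ hχu hχs) _ _
      (sumTensor (Fp L) ((seesawPerm e₁ e₀).trans (idxSplitD e₁ e₀ e₀)) Ψ Ψ₂)).symm.trans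
    ((congrArg (fun h => adelicMpCont.omega (Fp L) (Fin (nV + nV)) (gramDA L e₁ dV hdV dW hdW)
      (doubledWeilRep L e₁ dV hdV hdV0 dW hdW hdW0 χ hχu hχs h) (sumTensor (Fp L) ((seesawPerm e₁ e₀).trans (idxSplitD e₁ e₀ e₀)) Ψ Ψ₂)) hK2).trans
      (omega_apply_map_mul L dV hdV dW hdW e₁ (doubledWeilRep L e₁ dV hdV hdV0 dW hdW hdW0 χ hχu hχs) _ _
        (sumTensor (Fp L) ((seesawPerm e₁ e₀).trans (idxSplitD e₁ e₀ e₀)) Ψ Ψ₂)))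
  -- (W) the lift of the permutation acts by `c • R_ρ`, `c ≠ 0`
  refine (exists_omega_eq_smul_piSBReindex L e₁ e₀ he₀ dV hdV hdV0 hV dW hdW hdW0 hDV.proj_eq).elim fun c hc => ?_
  -- (R1b) on `σ`-tensors
  have hD := omega_blkD_inl_sumTensor L e₁ e₀ e₀ dA hdA hdA0 dB hdB hdB0 dV hdV hdV0 hVA hVB dW hdW hdW0 χ hχu hχs hDV hDA hDB h₁ Ψ Ψ₂
  -- the right-hand side of `hΩ` computed: `ω(B) (c • R_ρ S') = c • (ω_A Ψ) ⊠_σ Ψ₂ = ω(s δ′) ((ω_A Ψ) ⊠_{ρ ≫ σ} Ψ₂)`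
  have hR : adelicMpCont.omega (Fp L) (Fin (nV + nV)) (gramDA L e₁ dV hdV dW hdW)
        (doubledWeilRep L e₁ dV hdV hdV0 dW hdW hdW0 χ hχu hχs (blkD L e₁ e₀ e₀ dA hdA dB hdB dV hdV hVA hVB dW hdW (h₁, 1)))
        (adelicMpCont.omega (Fp L) (Fin (nV + nV)) (gramDA L e₁ dV hdV dW hdW)
          (doubledWeilRep L e₁ dV hdV hdV0 dW hdW hdW0 χ hχu hχs
            ⟨K2LiuUndoublingSeesawPermutation.permGL (seesawPerm e₁ e₀), permGL_seesawPerm_mem_HA L e₁ e₀ he₀ dV hdV hV dW hdW⟩)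
          (sumTensor (Fp L) ((seesawPerm e₁ e₀).trans (idxSplitD e₁ e₀ e₀)) Ψ Ψ₂)) =
      adelicMpCont.omega (Fp L) (Fin (nV + nV)) (gramDA L e₁ dV hdV dW hdW)
        (doubledWeilRep L e₁ dV hdV hdV0 dW hdW hdW0 χ hχu hχs
          ⟨K2LiuUndoublingSeesawPermutation.permGL (seesawPerm e₁ e₀), permGL_seesawPerm_mem_HA L e₁ e₀ he₀ dV hdV hV dW hdW⟩)
        (sumTensor (Fp L) ((seesawPerm e₁ e₀).trans (idxSplitD e₁ e₀ e₀))
          (adelicMpCont.omega (Fp L) (Fin (N + N)) (gramDA L e₀ dA hdA dW hdW)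
            (doubledWeilRep L e₀ dA hdA hdA0 dW hdW hdW0 χ hχu hχs h₁) Ψ) Ψ₂) := by
    -- (explicit congruence chain: `rw [hc.2]` keys on `ω(sD ·)` over the doubled telescopes — the isDefEq cliff)
    refine ((congrArg (adelicMpCont.omega (Fp L) (Fin (nV + nV)) (gramDA L e₁ dV hdV dW hdW)
      (doubledWeilRep L e₁ dV hdV hdV0 dW hdW hdW0 χ hχu hχs (blkD L e₁ e₀ e₀ dA hdA dB hdB dV hdV hVA hVB dW hdW (h₁, 1))))
      ((hc.2 _).trans (congrArg (fun Φ => c • Φ) (piSBReindex_sumTensor_trans (Fp L) (seesawPerm e₁ e₀) (idxSplitD e₁ e₀ e₀) Ψ Ψ₂)))).trans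
      ((((adelicMpCont.omega (Fp L) (Fin (nV + nV)) (gramDA L e₁ dV hdV dW hdW)
        (doubledWeilRep L e₁ dV hdV hdV0 dW hdW hdW0 χ hχu hχs
          (blkD L e₁ e₀ e₀ dA hdA dB hdB dV hdV hVA hVB dW hdW (h₁, 1)))).map_smul c _).trans
        (congrArg (fun Φ => c • Φ) hD)))).trans ?_
    exact ((hc.2 _).trans (congrArg (fun Φ => c • Φ)
      (piSBReindex_sumTensor_trans (Fp L) (seesawPerm e₁ e₀) (idxSplitD e₁ e₀ e₀) _ Ψ₂))).symm
  -- cancel `ω(s δ′)` (injective: `= c • R_ρ`, `c ≠ 0`)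
  have hinj : Function.Injective (adelicMpCont.omega (Fp L) (Fin (nV + nV)) (gramDA L e₁ dV hdV dW hdW)
      (doubledWeilRep L e₁ dV hdV hdV0 dW hdW hdW0 χ hχu hχs
        ⟨K2LiuUndoublingSeesawPermutation.permGL (seesawPerm e₁ e₀), permGL_seesawPerm_mem_HA L e₁ e₀ he₀ dV hdV hV dW hdW⟩)) := by
    intro a b hab
    have h' : c • piSBReindex (Fp L) (seesawPerm e₁ e₀) a = c • piSBReindex (Fp L) (seesawPerm e₁ e₀) b :=
      (hc.2 a).symm.trans (hab.trans (hc.2 b))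
    exact (piSBReindex (Fp L) (seesawPerm e₁ e₀)).injective (smul_right_injective _ hc.1 h')
  exact hinj (hΩ.trans hR)

/-! ## §2 THE MODEL IDENTIFICATION: `ω(s_χ(x ⊗ 1)) ∘ R_r = R_r ∘ ω(s^𝔻_{χ,(V₁,W)}(h₁))` -/

include he₀ hVA hVB hBA hdB in
/-- **MODEL (ii) ∘ inl = MODEL (i), on the nose.**  For `x ∈ U(V)(𝔸)`, `V = V₁ ⊕ (−V₁)`, and `h₁ ∈ H(V₁)(𝔸)` with the same matrix
(`H(V₁)(𝔸) = U(V)(𝔸)`, ★ `HA_e₀_eq_adelic`), the χ-attached compatible PAIR splitting of `(V, W)` (★ `chiSplitting χ = undoubleHom (doubledWeilRep χ)`,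
«`ι̃_{V,χ}` determined by doubling») at `x ⊗ 1` and the DOUBLED Weil representation of the datum `(V₁, W)` at `h₁` are the SAME operator up to the
row relabelling `R_r : 𝒮(𝔸^{N+N}) ≃ 𝒮(𝔸^{n_V})`, `r = rowEquiv e₁`:
`ω(s_χ(x ⊗ 1)) (R_r Ψ) = R_r (ω(s^𝔻_χ(h₁)) Ψ)` for every `Ψ`.  No twist, no generation hypothesis.
[cite: HarrisKudlaSweet1996, §1 (1.14)–(1.15), App. A Lem. A.2, Cor. A.3 p. 998] [cite: Kudla1994, §2 (doubled space, Siegel parabolic), Thm. 3.1]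
[cite: Liu2021, Thm. 4.15 proof l. 2199–2210, App. D §D.1 Step 2] [cite: Kudla1984, §1] -/
theorem omega_chiSplitting_adelicInl
    (x : UnitaryGroup.adelic (Fp L) L (IsCMField.complexConj L) (N + N) (Matrix.diagonal dV)) (h₁ : HA L e₀ dA hdA dW hdW)
    (hh₁ : (h₁ : GL (Fin (N + N)) (AdeleRing (𝓞 L) L)) = (x : GL (Fin (N + N)) (AdeleRing (𝓞 L) L)))
    (Ψ : piSchwartzBruhat (Fp L) (Fin (N + N))) :
    adelicMpCont.omega (Fp L) (Fin nV) (gramA L e₁ dV hdV dW hdW)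
        (chiSplitting L e₁ dV hdV hdV0 dW hdW hdW0 χ hχu hχs
          (UnitaryGroup.adelicInl (Fp L) L (IsCMField.complexConj L) (N + N) 1 (Matrix.diagonal dV) (Matrix.diagonal dW) x))
        (piSBReindex (Fp L) (rowEquiv e₁) Ψ) =
      piSBReindex (Fp L) (rowEquiv e₁)
        (adelicMpCont.omega (Fp L) (Fin (N + N)) (gramDA L e₀ dA hdA dW hdW)
          (doubledWeilRep L e₀ dA hdA hdA0 dW hdW hdW0 χ hχu hχs h₁) Ψ) := by
  have hDV := isDoubledWeilRep_doubledWeilRep L e₁ dV hdV hdV0 dW hdW hdW0 χ hχu hχs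
  -- the test function in the second slot
  have hT0 : piSBReindex (Fp L) (rowEquiv e₁) (testVec L (n := N + N)) ≠ 0 :=
    ((piSBReindex (Fp L) (rowEquiv e₁)).map_ne_zero_iff).mpr (testVec_ne_zero L)
  -- §1 on `Ψ ⊠_{ρ ≫ σ} T`
  have hE := omegaD_inlG_adelicInl_sumTensor L e₁ e₀ he₀ dA hdA hdA0 dB hdB dV hdV hdV0 hVA hVB hBA dW hdW hdW0 χ hχu hχs x h₁ hh₁ Ψ
    (testVec L (n := N + N))
  -- the shuffles `Ψ ⊠_{ρ ≫ σ} T = R⁻¹ (R_r Ψ ⊠ R_r T)` on both sides (congruence, no `rw`)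
  have hE' := ((congrArg (adelicMpCont.omega (Fp L) (Fin (nV + nV)) (gramDA L e₁ dV hdV dW hdW)
      (doubledWeilRep L e₁ dV hdV hdV0 dW hdW hdW0 χ hχu hχs
        (inlG L e₁ dV hdV dW hdW
          (UnitaryGroup.adelicInl (Fp L) L (IsCMField.complexConj L) (N + N) 1 (Matrix.diagonal dV) (Matrix.diagonal dW) x))))
      (sumTensor_seesawPerm_trans_idxSplitD (Fp L) e₁ e₀ Ψ (testVec L (n := N + N)))).symm.trans hE).trans
    (sumTensor_seesawPerm_trans_idxSplitD (Fp L) e₁ e₀ _ (testVec L (n := N + N)))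
  -- the undoubling product formula of `V`
  have hU := omegaD_inlG_piSBReindex_symm_tensorToSum L dW hdW hdW0 e₁ dV hdV hdV0 hDV.proj_eq
    (UnitaryGroup.adelicInl (Fp L) L (IsCMField.complexConj L) (N + N) 1 (Matrix.diagonal dV) (Matrix.diagonal dW) x)
    (piSBReindex (Fp L) (rowEquiv e₁) Ψ) (piSBReindex (Fp L) (rowEquiv e₁) (testVec L (n := N + N)))
  -- compare and cancel (`s_χ X` is `undouble s^𝔻_V X` by `rfl`)
  have key := tensorToSum_left_cancel hT0
    ((piSBReindex (Fp L) (finSumFinEquiv (m := nV) (n := nV)).symm).symm.injective (hU.symm.trans hE'))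
  exact key

/-! ## §3 The same with `h₁ := x` read in `H(V₁)(𝔸) = U(V)(𝔸)` -/

include hdB in
/-- **MODEL (ii) ∘ inl = MODEL (i)** with the canonical `h₁ := x ∈ H(V₁)(𝔸)` along ★ `HA_e₀_eq_adelic` (`dW 0 ≠ 0`).
[cite: HarrisKudlaSweet1996, §1 (1.14)–(1.15), App. A Lem. A.2, Cor. A.3 p. 998] [cite: Kudla1994, §2 (doubled space, Siegel parabolic), Thm. 3.1] -/
theorem omega_chiSplitting_adelicInl'
    (x : UnitaryGroup.adelic (Fp L) L (IsCMField.complexConj L) (N + N) (Matrix.diagonal dV))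
    (Ψ : piSchwartzBruhat (Fp L) (Fin (N + N))) :
    adelicMpCont.omega (Fp L) (Fin nV) (gramA L e₁ dV hdV dW hdW)
        (chiSplitting L e₁ dV hdV hdV0 dW hdW hdW0 χ hχu hχs
          (UnitaryGroup.adelicInl (Fp L) L (IsCMField.complexConj L) (N + N) 1 (Matrix.diagonal dV) (Matrix.diagonal dW) x))
        (piSBReindex (Fp L) (rowEquiv e₁) Ψ) =
      piSBReindex (Fp L) (rowEquiv e₁)
        (adelicMpCont.omega (Fp L) (Fin (N + N)) (gramDA L e₀ dA hdA dW hdW)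
          (doubledWeilRep L e₀ dA hdA hdA0 dW hdW hdW0 χ hχu hχs
            ⟨(x : GL (Fin (N + N)) (AdeleRing (𝓞 L) L)),
              (HA_e₀_eq_adelic L e₀ he₀ dV (dV_natAdd_eq_neg L dA dB dV hVA hVB hBA) dW hdW dA hdA hVA (hdW0 0)).symm ▸ x.2⟩) Ψ) :=
  omega_chiSplitting_adelicInl L e₁ e₀ he₀ dA hdA hdA0 dB hdB dV hdV hdV0 hVA hVB hBA dW hdW hdW0 χ hχu hχs x _ rfl Ψ

end Summit.HodgeConjecture.HodgeConjecture.Cruxes.HLiu418.K2LiuUndoublingSeesawAssembly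

end
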